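import Summits.BirchSwinnertonDyer.BirchSwinnertonDyer.Theorems.QuadraticBranchSignedControlPlusEtaNonsurjMuBound
import HarnessLib

/-!
# Route `QuadraticBranchSignedControl` (rung K8, cell `bsd-potss`), residual crux
# `PlusEtaMainConjectureNonsurj` (stmt-BirchSwinnertonDyer-19606): the TAMAGAWA ROWS of the rank-`0`
# sub-cut — `X⁺(V/K_∞)^η ≠ 0` there, and a DICHOTOMY: `μ(X⁺(V/K_∞)^η) = 0` OR `Char(X⁺(V/K_∞)^η) = (p)`
# exactly — file 1 of 2: the algebra in `Λ` and the `W`-side (seat `bsd-potss-k8eta-c2` g3)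

WHAT. Skeleton v3 of crux 19606 (planner g18) cuts its rank-`0` rows through `stub_etaMC_r0_mu`
(`μ(X⁺(V/K_∞)^η) = 0` in Greenberg–Vatsal's reading: every characteristic generator of every `η`-signed
plus dual datum has unit content). Below `5·10⁵` it has open content on exactly 7 rows (78300bh1,
159300l1, 162675n1, 404325f1, 164700i1, 164700n1, 417600fp1 at `p = 5`): the rows whose additive partner
`W` (`C • W^{(p*)} = V`) has `ord_p(#Sel_{p^∞}(W/ℚ)·Tam(W)) = 1` (seat g2's census; `μ ≤ 1` there by
`EtaMuBound.eta_le_of_C_pow_dvd_charGenerator`). THIS FILE pins the structure of those rows: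

* §0 (algebra in `Λ = ℤ_p⟦T⟧`) `hasUnitContent_or_span_eq_span_C_of_valuation_le_one`: `g(0) ≠ 0` and
  `v_p(g(0)) ≤ 1` ⟹ `p ∤ g` OR `(g) = (p)` (if `g = p·h` then `h(0)` is a unit, so `h ∈ Λˣ`); the two
  cases exclude each other; `v_p(g(0)) ≠ 0 ⟹ g ∉ Λˣ`.
* §1 (`W`-side, every plus dual datum `D` of `Sel⁺(W/ℚ_∞)`) on a row with
  `ord_p #Sel_{p^∞}(W/ℚ) + ord_p Tam(W) ≤ 1`: **`μ = 0` OR `Char(X) = (p)`** — UNCONDITIONAL (g2's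
  Poitou–Tate-free bound `v_p(g(0)) ≤ ord_p #Sel + ord_p Tam`); and WITH Poitou–Tate (`hPT`) + no finite
  submodule, on a row with `ord_p #Sel + ord_p Tam = 1`: **`v_p(g(0)) = 1` exactly, `Char(X) ≠ Λ`,
  `X ≠ 0`** (ctrl g4's exact even control `finite_and_padicValNat_card_selmerGroupPInfty_add_eq_of_charIdeal_eq`
  = B. D. Kim's formula with the main conjecture removed).
* sequel (`…PlusEtaNonsurjTamagawaDichotomyEta.lean`): the same at `η` for every `η`-signed plus dual
  datum of `V` over an abstract `ℚ(μ_p)` ((D5⁺)⁻¹), the `stub_etaMC_r0_mu` reading, and the reading of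
  Kobayashi's conjecture on these rows (its falsifiable prediction for `L_p⁺(V,η,X)`).

HONEST FRAMING (cell `bsd-potss`, run/shared/lean/pub/bsd-potss/; FULL-BSD rank ≤ 1 programme,
tranche 1b, HUMAN RULING D-0036/D-0074): TOOL THEOREMS ONLY — no definition, no named Literature
fact minted, no Summits-side `def … : Prop`, no `sorry`, axioms standard. The dichotomy is
UNCONDITIONAL (per-row input `Sel_{p^∞}(W/ℚ)` finite displayed); the exactness statements are
CONDITIONAL on Poitou–Tate duality (`poitouTate_selmerStructure_duality_real ℚ`, named fact, hypothesis
position) and on the displayed «no finite submodule» binder. Nothing about (C1⁺_η) is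
claimed; `stub_etaMC_r0_mu` is NOT proved (nor refuted) on any Tamagawa row; the crux 19606 stays OPEN;
nothing is booked; no label / mark / count moves. `--supports stmt-BirchSwinnertonDyer-19606`.

References: [GreenbergLNM1716] §3 Lemma 3.3 (pp. 86–88), §4 Thm. 4.1 and Lemma 4.2 (p. 102);
[GreenbergVatsal2000] p. 2 (1)–(2); [Kobayashi2003] §4 Even main conjecture and Thm. 4.1 (p. 8),
Thm. 9.3 with (9.33) (pp. 26–27); [KitajimaOtsuki2018] Main Thm. 1.3; [MilneADT2006] Ch. I Thm. 4.10;
[Washington1997] §7.1 (units of `Λ`), §13.2; [MazurTateTeitelbaum1986Invent] §I.17 (functional equation).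
-/

set_option autoImplicit false
set_option linter.dupNamespace false

noncomputable section

open scoped Classical

open CongruenceSubgroup Field Function NumberField IsDedekindDomain WeierstrassCurve
open Literature.NumberTheory.EllipticCurves
open Literature.NumberTheory.EllipticCurves.ModularForms
open Literature.NumberTheory.EllipticCurves.Rank1Residual
open Literature.NumberTheory.EllipticCurves.Rank1Residual.Typed
open Literature.NumberTheory.GaloisRepresentations
open Literature.NumberTheory.GaloisCohomology
open Literature.NumberTheory.EllipticCurves.IwasawaAlgebra
open Literature.NumberTheory.EllipticCurves.IwasawaDual ZpExtension
open Literature.NumberTheory.EllipticCurves.GreenbergVatsal2000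
open Summit.BirchSwinnertonDyer.Rank1Residual.X11b.Levels
open Summit.BirchSwinnertonDyer.Rank1Residual.X11b
open Summit.BirchSwinnertonDyer.Rank1Residual.Additive
open Summit.BirchSwinnertonDyer.Rank1Residual.Additive.SignedTwist
open scoped ContRepresentation
open Summit.BirchSwinnertonDyer.Rank1Residual.AdditivePotMult

namespace Summit.BirchSwinnertonDyer.BirchSwinnertonDyer.Theorems

namespace EtaTamagawaDichotomy

/-! ## §0 Algebra in `Λ = ℤ_p⟦T⟧`: `v_p(g(0)) ≤ 1` forces `p ∤ g` or `(g) = (p)` -/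

section Algebra

variable {p : ℕ} [hp : Fact p.Prime]

/-- **`g(0) ≠ 0` and `v_p(g(0)) ≤ 1` ⟹ `g` has unit content OR `(g) = (p)` in `Λ`.** If `p ∣ g`, write
`g = p·h`; then `v_p(h(0)) = v_p(g(0)) − 1 ≤ 0`, so `h(0) ∈ ℤ_pˣ`, so `h ∈ Λˣ` (a power series is a
unit iff its constant term is) and `(g) = (p)`. [cite: Washington1997, §7.1 (units of Λ)]
[cite: GreenbergVatsal2000, p. 2 (2)] -/
theorem hasUnitContent_or_span_eq_span_C_of_valuation_le_one {g : IwasawaAlgebra p}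
    (h0 : PowerSeries.constantCoeff g ≠ 0)
    (hle : ((PowerSeries.constantCoeff g : ℤ_[p]) : ℚ_[p]).valuation ≤ 1) :
    HasUnitContent g ∨
      Ideal.span ({g} : Set (IwasawaAlgebra p)) = Ideal.span {PowerSeries.C (p : ℤ_[p])} := by
  by_cases hu : HasUnitContent g
  · exact Or.inl hu
  right
  rw [hasUnitContent_iff_not_C_dvd, not_not] at hu
  obtain ⟨h, rfl⟩ := hu
  have hmul : PowerSeries.constantCoeff (PowerSeries.C (p : ℤ_[p]) * h) =
      (p : ℤ_[p]) * PowerSeries.constantCoeff h := by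
    rw [map_mul, PowerSeries.constantCoeff_C]
  have hh0 : PowerSeries.constantCoeff h ≠ 0 := fun hz ↦ h0 (by rw [hmul, hz, mul_zero])
  have hp0 : (p : ℤ_[p]) ≠ 0 := by exact_mod_cast hp.out.ne_zero
  -- `v_p(h(0)) = 0`
  have hval : (PowerSeries.constantCoeff h).valuation = 0 := by
    rw [hmul, PadicInt.valuation_coe, PadicInt.valuation_mul hp0 hh0, PadicInt.valuation_p] at hle
    push_cast at hle
    omega
  -- hence `h(0)` is a unit of `ℤ_p`, `h` a unit of `Λ`
  have hunit : IsUnit (PowerSeries.constantCoeff h) := by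
    rw [PadicInt.isUnit_iff, PadicInt.norm_eq_zpow_neg_valuation hh0, hval]
    simp
  have hU : IsUnit h := PowerSeries.isUnit_iff_constantCoeff.mpr hunit
  exact Ideal.span_singleton_mul_right_unit hU _

/-- The two cases of the dichotomy EXCLUDE each other: `(g) = (p)` ⟹ `p ∣ g` ⟹ no unit content.
[cite: GreenbergVatsal2000, p. 2 (2)] -/
theorem not_hasUnitContent_of_span_eq_span_C {g : IwasawaAlgebra p}
    (h : Ideal.span ({g} : Set (IwasawaAlgebra p)) = Ideal.span {PowerSeries.C (p : ℤ_[p])}) :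
    ¬ HasUnitContent g := by
  rw [hasUnitContent_iff_not_C_dvd, not_not, ← Ideal.mem_span_singleton, ← h]
  exact Ideal.mem_span_singleton_self g

/-- `v_p(g(0)) ≠ 0` ⟹ `g ∉ Λˣ` (a unit power series has a unit constant term, of valuation `0`).
[cite: Washington1997, §7.1] -/
theorem not_isUnit_of_valuation_constantCoeff_ne_zero {g : IwasawaAlgebra p}
    (hv : ((PowerSeries.constantCoeff g : ℤ_[p]) : ℚ_[p]).valuation ≠ 0) : ¬ IsUnit g := by
  intro hu
  apply hv
  have hc : IsUnit (PowerSeries.constantCoeff g) := PowerSeries.isUnit_iff_constantCoeff.mp hu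
  have hn : ‖(PowerSeries.constantCoeff g : ℤ_[p])‖ = 1 := PadicInt.isUnit_iff.mp hc
  have h0 : PowerSeries.constantCoeff g ≠ 0 := hc.ne_zero
  rw [PadicInt.norm_eq_zpow_neg_valuation h0] at hn
  have hp1 : (1 : ℝ) < p := by exact_mod_cast hp.out.one_lt
  have hz : (PowerSeries.constantCoeff g).valuation = 0 := by
    by_contra hne
    have hneg : (-((PowerSeries.constantCoeff g).valuation : ℤ)) < 0 := by omega
    exact (zpow_lt_one_of_neg₀ hp1 hneg).ne hn
  rw [PadicInt.valuation_coe, hz]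
  rfl

/-- `v_p(g(0)) ≠ 0` ⟹ `(g) ≠ Λ`. [cite: Washington1997, §7.1] -/
theorem span_ne_top_of_valuation_constantCoeff_ne_zero {g : IwasawaAlgebra p}
    (hv : ((PowerSeries.constantCoeff g : ℤ_[p]) : ℚ_[p]).valuation ≠ 0) :
    Ideal.span ({g} : Set (IwasawaAlgebra p)) ≠ ⊤ := by
  rw [Ne, Ideal.span_singleton_eq_top]
  exact not_isUnit_of_valuation_constantCoeff_ne_zero hv

end Algebra

/-! ## §1 `W`-side: the plus dual data of `Sel⁺(W/ℚ_∞)` on a row with `ord_p(#Sel·Tam) ≤ 1` -/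

section Twist

variable {p : ℕ} [hp : Fact p.Prime] (κ : ZpExtension ℚ p) (W : WeierstrassCurve ℚ) [W.IsElliptic]
  [W.IsGloballyMinimal]

/-- **DICHOTOMY (`W`-side, unconditional).** `W` globally minimal the `p*`-twist partner of a globally
minimal good `a_p = 0` curve `V` (`C • W^{(p*)} = V`), `p ≥ 5`, `κ` cyclotomic with topological
generator `γ`, `Sel_{p^∞}(W/ℚ)` finite with **`ord_p #Sel_{p^∞}(W/ℚ) + ord_p Tam(W) ≤ 1`**. Then for
EVERY plus dual datum `D` of `Sel⁺(W/ℚ_∞)` and every generator `g` of `Char(X)`: **`g` has unit content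
(`μ = 0`) OR `Char(X) = (p)`**. From g2's Poitou–Tate-free bound `v_p(g(0)) ≤ ord_p #Sel + ord_p Tam`
(`EtaMuBound.valuation_charGenerator_le_selmer_add_tamagawa`) and §0.
[cite: GreenbergLNM1716, §3 Lemma 3.3, §4 Lemma 4.2 (p. 102)] [cite: GreenbergVatsal2000, p. 2 (2)]
[cite: Kobayashi2003, Thm. 9.3 with (9.33) (pp. 26–27)] -/
theorem hasUnitContent_or_charIdeal_eq_span_C (hp5 : 5 ≤ p) (hκ : κ.IsCyclotomic)
    (C : VariableChange ℚ) (V : WeierstrassCurve ℚ) [V.IsElliptic] [V.IsGloballyMinimal]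
    (hCV : C • W.quadraticTwist ((-1) ^ (p / 2) * p) = V)
    (hgood : V.HasGoodReductionAtPrime p) (hap : V.frobeniusTrace p = 0)
    {γ : Field.absoluteGaloisGroup ℚ} (hγ : κ.IsTopGenerator γ)
    [Finite ↥(W.selmerGroupPInfty p)]
    (hle1 : padicValNat p (Nat.card ↥(W.selmerGroupPInfty p)) + padicValNat p W.tamagawaProduct ≤ 1)
    (D : StrictSignedSelmerDualData W κ ℚ_[p] γ 1)
    {g : IwasawaAlgebra p} (hg : D.charIdeal = Ideal.span {g}) :
    HasUnitContent g ∨ D.charIdeal = Ideal.span {PowerSeries.C (p : ℤ_[p])} := by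
  obtain ⟨h0, hle⟩ :=
    EtaMuBound.valuation_charGenerator_le_selmer_add_tamagawa κ W hp5 hκ C V hCV hgood hap hγ D hg
  have hle' : ((PowerSeries.constantCoeff g : ℤ_[p]) : ℚ_[p]).valuation ≤ 1 :=
    hle.trans (by exact_mod_cast hle1)
  rw [hg]
  exact hasUnitContent_or_span_eq_span_C_of_valuation_le_one h0 hle'

/-- **EXACTNESS (`W`-side, Poitou–Tate).** Same row hypotheses with **`ord_p #Sel_{p^∞}(W/ℚ) +
ord_p Tam(W) = 1`**, Poitou–Tate duality `hPT`, and a plus dual datum `D` whose `X` has NO non-trivial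
finite `Λ`-submodule: every generator `g` of `Char(X)` has **`v_p(g(0)) = 1` exactly** — ctrl g4's exact
even control `finite_and_padicValNat_card_selmerGroupPInfty_add_eq_of_charIdeal_eq` (B. D. Kim's formula
with the main conjecture removed: `ord_p #Sel + ord_p(Tam/#tors²) = v_p(g(0))`), `X` f.g. torsion with
`g(0) ≠ 0` from `Sel` finite (g2's `EtaBottomLayer.isTorsion_and_constantCoeff_ne_zero_of_finite_selmer`),
and `p ∤ #W(ℚ)_tors` (`V` good supersingular). CONDITIONAL on `hPT`.
[cite: GreenbergLNM1716, §4 Thm. 4.1 and Lemma 4.2 (p. 102)] [cite: MilneADT2006, Ch. I Thm. 4.10]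
[cite: Kobayashi2003, Thm. 9.3 with (9.33) (pp. 26–27)] -/
theorem valuation_charGenerator_eq_one (hPT : poitouTate_selmerStructure_duality_real ℚ) (hp5 : 5 ≤ p)
    (hκ : κ.IsCyclotomic) (C : VariableChange ℚ) (V : WeierstrassCurve ℚ) [V.IsElliptic]
    [V.IsGloballyMinimal] (hCV : C • W.quadraticTwist ((-1) ^ (p / 2) * p) = V)
    (hgood : V.HasGoodReductionAtPrime p) (hap : V.frobeniusTrace p = 0)
    {γ : Field.absoluteGaloisGroup ℚ} (hγ : κ.IsTopGenerator γ)
    [Finite ↥(W.selmerGroupPInfty p)]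
    (heq1 : padicValNat p (Nat.card ↥(W.selmerGroupPInfty p)) + padicValNat p W.tamagawaProduct = 1)
    (D : StrictSignedSelmerDualData W κ ℚ_[p] γ 1)
    (hnf : ∀ N : Submodule (IwasawaAlgebra p) D.X, Finite N → N = ⊥)
    {g : IwasawaAlgebra p} (hg : D.charIdeal = Ideal.span {g}) :
    ((PowerSeries.constantCoeff g : ℤ_[p]) : ℚ_[p]).valuation = 1 := by
  have hp2 : p ≠ 2 := by omega
  obtain ⟨hfg, htor, hall⟩ :=
    EtaBottomLayer.isTorsion_and_constantCoeff_ne_zero_of_finite_selmer κ W hp2 hκ C V hCV hgood hap hγ D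
  haveI := hfg
  have h0 : PowerSeries.constantCoeff g ≠ 0 := (hall g hg).2
  obtain ⟨-, hcount⟩ := ConverseControl.finite_and_padicValNat_card_selmerGroupPInfty_add_eq_of_charIdeal_eq W p
    hPT V C hp5
    hCV hgood hap hκ hγ D htor hnf hg h0
  -- `p ∤ #W(ℚ)_tors`: the torsion term of B. D. Kim's formula vanishes
  have htors := eq_zero_of_prime_smul_eq_zero_padic_of_quadraticTwist_goodSupersingular hp2 W C V hCV hgood hap
  have htors0 := LevelBridge.padicValNat_torsionOrder_eq_zero_of_noPTorsion W p htors
  have hTamQ : (W.tamagawaProduct : ℚ) ≠ 0 := by exact_mod_cast W.tamagawaProduct_pos_holds.ne'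
  have htQ : (W.torsionOrder : ℚ) ≠ 0 := by exact_mod_cast W.torsionOrder_pos_holds.ne'
  have hrat : padicValRat p ((W.tamagawaProduct : ℚ) / (W.torsionOrder : ℚ) ^ 2) =
      (padicValNat p W.tamagawaProduct : ℤ) := by
    rw [padicValRat.div hTamQ (pow_ne_zero 2 htQ), padicValRat.pow, padicValRat.of_nat, padicValRat.of_nat,
      htors0]
    simp
  rw [← hcount, hrat]
  exact_mod_cast heq1

/-- **`X⁺_W(ℚ_∞) ≠ 0` and `Char ≠ Λ` on the Tamagawa rows** (hypotheses of
`valuation_charGenerator_eq_one`): the characteristic ideal of every plus dual datum with no finite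
submodule is a PROPER ideal (its generator has `v_p(g(0)) = 1`), so `X` is not the zero module
(g2's `EtaBottomLayer.charIdeal_eq_top_of_subsingleton`). CONDITIONAL on `hPT`.
[cite: GreenbergLNM1716, §4 Thm. 4.1 (p. 102)] [cite: Kobayashi2003, §4 p. 8] -/
theorem charIdeal_ne_top_and_nontrivial (hPT : poitouTate_selmerStructure_duality_real ℚ) (hp5 : 5 ≤ p)
    (hκ : κ.IsCyclotomic) (C : VariableChange ℚ) (V : WeierstrassCurve ℚ) [V.IsElliptic]
    [V.IsGloballyMinimal] (hCV : C • W.quadraticTwist ((-1) ^ (p / 2) * p) = V)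
    (hgood : V.HasGoodReductionAtPrime p) (hap : V.frobeniusTrace p = 0)
    {γ : Field.absoluteGaloisGroup ℚ} (hγ : κ.IsTopGenerator γ)
    [Finite ↥(W.selmerGroupPInfty p)]
    (heq1 : padicValNat p (Nat.card ↥(W.selmerGroupPInfty p)) + padicValNat p W.tamagawaProduct = 1)
    (D : StrictSignedSelmerDualData W κ ℚ_[p] γ 1)
    (hnf : ∀ N : Submodule (IwasawaAlgebra p) D.X, Finite N → N = ⊥) :
    D.charIdeal ≠ ⊤ ∧ Nontrivial D.X := by
  haveI : D.charIdeal.IsPrincipal := charIdeal_isPrincipal_holds p D.X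
  obtain ⟨g, hg⟩ := Submodule.IsPrincipal.principal D.charIdeal
  have hg' : D.charIdeal = Ideal.span {g} := hg
  have hv := valuation_charGenerator_eq_one κ W hPT hp5 hκ C V hCV hgood hap hγ heq1 D hnf hg'
  have hne : D.charIdeal ≠ ⊤ := by
    rw [hg']
    exact span_ne_top_of_valuation_constantCoeff_ne_zero (by rw [hv]; exact one_ne_zero)
  refine ⟨hne, ?_⟩
  by_contra hX
  rw [not_nontrivial_iff_subsingleton] at hX
  exact hne (EtaBottomLayer.charIdeal_eq_top_of_subsingleton D)

/-- **EXACT DICHOTOMY (`W`-side, Poitou–Tate).** On a row with `ord_p #Sel + ord_p Tam = 1`, for a plus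
dual datum with no finite submodule and `Char = (g)`: `g ∉ Λˣ` AND (`p ∤ g` OR `(g) = (p)`), the two
cases exclusive — i.e. `(μ, λ) = (0, ≥ 1)` or `Char(X⁺_W(ℚ_∞)) = (p)`. CONDITIONAL on `hPT`.
[cite: GreenbergLNM1716, §4 Thm. 4.1 and Lemma 4.2] [cite: GreenbergVatsal2000, p. 2 (1)–(2)] -/
theorem not_isUnit_and_dichotomy (hPT : poitouTate_selmerStructure_duality_real ℚ) (hp5 : 5 ≤ p)
    (hκ : κ.IsCyclotomic) (C : VariableChange ℚ) (V : WeierstrassCurve ℚ) [V.IsElliptic]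
    [V.IsGloballyMinimal] (hCV : C • W.quadraticTwist ((-1) ^ (p / 2) * p) = V)
    (hgood : V.HasGoodReductionAtPrime p) (hap : V.frobeniusTrace p = 0)
    {γ : Field.absoluteGaloisGroup ℚ} (hγ : κ.IsTopGenerator γ)
    [Finite ↥(W.selmerGroupPInfty p)]
    (heq1 : padicValNat p (Nat.card ↥(W.selmerGroupPInfty p)) + padicValNat p W.tamagawaProduct = 1)
    (D : StrictSignedSelmerDualData W κ ℚ_[p] γ 1)
    (hnf : ∀ N : Submodule (IwasawaAlgebra p) D.X, Finite N → N = ⊥)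
    {g : IwasawaAlgebra p} (hg : D.charIdeal = Ideal.span {g}) :
    ¬ IsUnit g ∧
      (HasUnitContent g ∨ D.charIdeal = Ideal.span {PowerSeries.C (p : ℤ_[p])}) ∧
      ¬ (HasUnitContent g ∧ D.charIdeal = Ideal.span {PowerSeries.C (p : ℤ_[p])}) := by
  have hv := valuation_charGenerator_eq_one κ W hPT hp5 hκ C V hCV hgood hap hγ heq1 D hnf hg
  refine ⟨not_isUnit_of_valuation_constantCoeff_ne_zero (by rw [hv]; exact one_ne_zero),
    hasUnitContent_or_charIdeal_eq_span_C κ W hp5 hκ C V hCV hgood hap hγ heq1.le D hg, ?_⟩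
  rintro ⟨hu, hspan⟩
  exact not_hasUnitContent_of_span_eq_span_C (hg.symm.trans hspan) hu

end Twist

end EtaTamagawaDichotomy

end Summit.BirchSwinnertonDyer.BirchSwinnertonDyer.Theorems

end
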